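import Literature.Probability.RandomPlanarGeometry.HexSAWBrickWallBridges
import Literature.Probability.RandomPlanarGeometry.SAWHalfSpaceConcat
import HarnessLib

/-!
# Half-space walks of the hexagonal lattice in brick-wall coordinates:
# `b_k(ℍ) · h_n(ℍ) ≤ h_{k+n}(ℍ)`, `h_n(ℍ) ≤ h_{n+2}(ℍ)`, `h_{n+k}(ℍ) ≤ h_n(ℍ) · c_k(ℍ)`

Topic `Literature/Probability/RandomPlanarGeometry` (continues `HexSAWBrickWallWalks.lean`: `HexBW.saws`,
`HexBW.bridges`, `HexBW.halfSpaceWalks` — honeycomb walks read in the brick wall `brickWallGraph ⊆ ℤ²`, height =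
coordinate `0`, the parity twist `twistAt`; and `HexSAWBrickWallBridges.lean`: the twisted concatenation
`HexBW.concat`, `b_m b_n ≤ b_{m+n}`).  The `ℤ^d` versions are the tree's `Zd.bridgeCount_mul_halfSpaceCount_le`
(`SAWHalfSpaceConcat.lean`) and `Zd.count_add_le` (`SAWCount.lean`); as there, the graph-free statements
(`Zd.concatWalk_mem_halfSpaceWalks`, `Zd.concatWalk_injective_pieces`) are used AS IS and only the brick-wall
steps (with the parity twist where a walk is read from / placed at a site of odd parity) are new.

Sources: N. Madras, G. Slade, *The Self-Avoiding Walk* (1993), Definition 3.1.2 (half-space walks), §1.2 eq.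
(1.2.3) (`c_{n+m} ≤ c_n c_m`: splitting a walk) and eq. (1.2.15) (concatenation with a bridge), Lemma 7.3.1
hypothesis (ii) (`a_N ≤ a_{N+2}`); G. F. Lawler, O. Schramm, W. Werner, *On the scaling limit of planar
self-avoiding walk* (2004), Appendix A (half-space walks: a bridge followed by a half-space walk is a
half-space walk).  Lane «pcv-sawmu», inputs `HexBridgeHalfSpaceSup`, `HexHalfSpaceMonoTwo`, `HexHalfSpaceSub` of
route R79 «HEX-HALFSPACE-RATIO-2-RATE».

## Contents (namespace `Literature.Probability.RandomPlanarGeometry.SAW.HexBW`, all PROVED)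

* `isBW_concat`, `concat_mem_halfSpaceWalks` — a bridge followed by the (twisted, translated) half-space walk is
  a half-space walk of `ℍ`;
* **`bridgeCount_mul_halfSpaceCount_le : b_k(ℍ) · h_n(ℍ) ≤ h_{k+n}(ℍ)`**, `halfSpaceCount_le_add_left`,
  **`halfSpaceCount_le_add_two : h_n(ℍ) ≤ h_{n+2}(ℍ)`**, `one_le_halfSpaceCount`;
* `prefix_mem`, `suffix_mem`, `prefix_suffix_injOn` (the twisted split) and
  **`halfSpaceCount_add_le : h_{n+k}(ℍ) ≤ h_n(ℍ) · c_k(ℍ)`**,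
  `card_saws_add_le : c_{n+k}(ℍ) ≤ c_n(ℍ) · c_k(ℍ)` (re-derived in the function model).
-/

noncomputable section

open Finset Function Literature.Probability.LatticeModels Literature.Probability.Percolation SimpleGraph

namespace Literature.Probability.RandomPlanarGeometry.SAW

namespace HexBW

/-! ### A bridge followed by a half-space walk -/

/-- The twisted concatenation of two honeycomb walks has brick-wall steps. [cite: MadrasSlade1993, §1.2, eq. (1.2.15)] -/
theorem isBW_concat {m n : ℕ} {ω υ : ℕ → Site 2} (hω : ω ∈ saws m) (hυ : υ ∈ saws n) :
    IsBW (m + n) (concat m ω υ) := by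
  obtain ⟨-, hωst⟩ := mem_saws.1 hω
  obtain ⟨hυZ, hυst⟩ := mem_saws.1 hυ
  have hυ0 := (Zd.mem_saws.1 hυZ).1
  intro i hi
  by_cases h : i + 1 ≤ m
  · simp only [concat, Zd.concatWalk, if_pos h, if_pos (Nat.le_of_succ_le h)]
    exact hωst i (by omega)
  · by_cases h' : i ≤ m
    · have him : i = m := by omega
      subst him
      simp only [concat, Zd.concatWalk, if_pos le_rfl, if_neg h, Nat.add_sub_cancel_left]
      have key := (adj_add_twistAt_iff (ω i) (υ 0) (υ 1)).2 (hυst 0 (by omega))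
      rwa [hυ0, twistAt_zero, add_zero] at key
    · simp only [concat, Zd.concatWalk, if_neg h, if_neg h', show i + 1 - m = (i - m) + 1 by omega]
      exact (adj_add_twistAt_iff (ω m) _ _).2 (hυst (i - m) (by omega))

/-- The twist of a honeycomb half-space walk is a `ℤ²` half-space walk. [cite: MadrasSlade1993, Definition 3.1.2] -/
theorem twistAt_comp_mem_zdHalfSpaceWalks {n : ℕ} {υ : ℕ → Site 2} (p : Site 2) (hυ : υ ∈ halfSpaceWalks n) :
    (fun i => twistAt p (υ i)) ∈ Zd.halfSpaceWalks 2 n := by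
  obtain ⟨hυS, hυh⟩ := mem_halfSpaceWalks.1 hυ
  exact Zd.mem_halfSpaceWalks.2
    ⟨twistAt_comp_mem_zdSaws p (saws_subset n hυS), (isHalfSpace_twistAt_comp_iff p).2 hυh⟩

/-- **A `k`-step bridge followed by (the twisted translate of) an `n`-step half-space walk is a `(k+n)`-step
half-space walk of `ℍ`.** [cite: LawlerSchrammWerner2004SAW, Appendix A (concatenation of bridges and half-space walks); MadrasSlade1993, §1.2, eq. (1.2.15)] -/
theorem concat_mem_halfSpaceWalks {k n : ℕ} {ω υ : ℕ → Site 2} (hω : ω ∈ bridges k)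
    (hυ : υ ∈ halfSpaceWalks n) : concat k ω υ ∈ halfSpaceWalks (k + n) := by
  have hZ := Zd.concatWalk_mem_halfSpaceWalks (bridges_subset_zd k hω)
    (twistAt_comp_mem_zdHalfSpaceWalks (ω k) hυ)
  obtain ⟨hZs, hZh⟩ := Zd.mem_halfSpaceWalks.1 hZ
  exact mem_halfSpaceWalks.2
    ⟨mem_saws.2 ⟨hZs, isBW_concat (mem_bridges.1 hω).1 (mem_halfSpaceWalks.1 hυ).1⟩, hZh⟩

/-- **`b_k(ℍ) · h_n(ℍ) ≤ h_{k+n}(ℍ)`** ("mixed supermultiplicativity": a bridge, then a half-space walk from its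
top; injective). [cite: LawlerSchrammWerner2004SAW, Appendix A; MadrasSlade1993, §1.2, eq. (1.2.15)] -/
theorem bridgeCount_mul_halfSpaceCount_le (k n : ℕ) :
    bridgeCount k * halfSpaceCount n ≤ halfSpaceCount (k + n) := by
  classical
  rw [bridgeCount, halfSpaceCount, halfSpaceCount, ← Finset.card_product]
  refine Finset.card_le_card_of_injOn (fun p => concat k p.1 p.2) ?_ ?_
  · rintro ⟨ω, υ⟩ hp
    simp only [Finset.mem_coe, Finset.mem_product] at hp
    exact concat_mem_halfSpaceWalks hp.1 hp.2
  · rintro ⟨ω, υ⟩ hp ⟨ω', υ'⟩ hp' h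
    simp only [Finset.mem_coe, Finset.mem_product] at hp hp'
    have hωZ := saws_subset k (mem_bridges.1 hp.1).1
    have hω'Z := saws_subset k (mem_bridges.1 hp'.1).1
    have hυZ := saws_subset n (mem_halfSpaceWalks.1 hp.2).1
    have hυ'Z := saws_subset n (mem_halfSpaceWalks.1 hp'.2).1
    obtain ⟨h1, h2⟩ := Zd.concatWalk_injective_pieces hωZ (twistAt_comp_mem_zdSaws (ω k) hυZ) hω'Z
      (twistAt_comp_mem_zdSaws (ω' k) hυ'Z) h
    subst h1
    have h3 : υ = υ' := funext fun i => twistAt_injective (ω k) (congrFun h2 i)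
    rw [h3]

/-- `1 ≤ h_n(ℍ)` (the straight walk is a bridge, hence a half-space walk). [cite: MadrasSlade1993, §3.1] -/
theorem one_le_halfSpaceCount (n : ℕ) : 1 ≤ halfSpaceCount n :=
  le_trans (one_le_bridgeCount n) (Finset.card_le_card (bridges_subset_halfSpaceWalks n))

/-- `h_n(ℍ) ≤ h_{m+n}(ℍ)` (prepend an `m`-step bridge, `b_m ≥ 1`). [cite: MadrasSlade1993, Lemma 7.3.1 (hypothesis (ii)); LawlerSchrammWerner2004SAW, Appendix A] -/
theorem halfSpaceCount_le_add_left (m n : ℕ) : halfSpaceCount n ≤ halfSpaceCount (m + n) :=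
  le_trans (Nat.le_mul_of_pos_left _ (one_le_bridgeCount m)) (bridgeCount_mul_halfSpaceCount_le m n)

/-- **`h_n(ℍ) ≤ h_{n+2}(ℍ)`** — hypothesis (ii) of Kesten's Lemma 7.3.1 for `φ_N = h_{N+2}(ℍ)/h_N(ℍ)`.
[cite: MadrasSlade1993, Lemma 7.3.1 (hypothesis (ii))] -/
theorem halfSpaceCount_le_add_two (n : ℕ) : halfSpaceCount n ≤ halfSpaceCount (n + 2) := by
  rw [add_comm]
  exact halfSpaceCount_le_add_left 2 n

/-! ### Splitting a walk: `h_{n+k} ≤ h_n · c_k`, `c_{n+k} ≤ c_n · c_k`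

Below, the PREFIX of `ω` is `fun i => ω (min i n)` (its first `n` steps) and the (twisted) SUFFIX is
`fun i => twistAt (ω n) (ω (n + min i k) - ω n)` (its last `k` steps read at the origin from the site `ω n`);
they are written out in the statements (no auxiliary definitions). -/

/-- The prefix (first `n` steps) of a honeycomb walk is a honeycomb walk. [cite: MadrasSlade1993, §1.2, eq. (1.2.3)] -/
theorem prefix_mem {n k : ℕ} {ω : ℕ → Site 2} (hω : ω ∈ saws (n + k)) :
    (fun i => ω (min i n)) ∈ saws n := by
  obtain ⟨h0, -, hbw, hinj⟩ := mem_saws_iff.1 hω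
  refine mem_saws_iff.2 ⟨by simp [h0], fun i hi => by simp [min_eq_right hi], ?_, ?_⟩
  · intro i hi
    simp only [min_eq_left hi.le, min_eq_left (by omega : i + 1 ≤ n)]
    exact hbw i (by omega)
  · intro i hi j hj hij
    simp only [Set.mem_setOf_eq] at hi hj
    simp only [min_eq_left hi, min_eq_left hj] at hij
    exact hinj (show i ≤ n + k by omega) (show j ≤ n + k by omega) hij

/-- The prefix of a half-space walk is a half-space walk. [cite: MadrasSlade1993, Definition 3.1.2] -/
theorem prefix_mem_halfSpaceWalks {n k : ℕ} {ω : ℕ → Site 2} (hω : ω ∈ halfSpaceWalks (n + k)) :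
    (fun i => ω (min i n)) ∈ halfSpaceWalks n := by
  obtain ⟨hS, hh⟩ := mem_halfSpaceWalks.1 hω
  refine mem_halfSpaceWalks.2 ⟨prefix_mem hS, fun i h1 h2 => ?_⟩
  simp only [Nat.zero_min, min_eq_left h2]
  exact hh i h1 (by omega)

/-- The twisted suffix (last `k` steps, read at the origin from `ω n`) of a honeycomb walk is a honeycomb walk
from `0`. [cite: MadrasSlade1993, §1.2, eq. (1.2.3)] -/
theorem suffix_mem {n k : ℕ} {ω : ℕ → Site 2} (hω : ω ∈ saws (n + k)) :
    (fun i => twistAt (ω n) (ω (n + min i k) - ω n)) ∈ saws k := by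
  obtain ⟨-, hend, hbw, hinj⟩ := mem_saws_iff.1 hω
  refine mem_saws_iff.2 ⟨by simp, fun i hi => by simp [min_eq_right hi], ?_, ?_⟩
  · intro i hi
    simp only [min_eq_left hi.le, min_eq_left (by omega : i + 1 ≤ k), ← add_assoc]
    exact (adj_twistAt_sub_iff (ω n) _ _).2 (hbw (n + i) (by omega))
  · intro i hi j hj hij
    simp only [Set.mem_setOf_eq] at hi hj
    simp only [min_eq_left hi, min_eq_left hj] at hij
    have h1 := twistAt_injective (ω n) hij
    rw [sub_left_inj] at h1
    have := hinj (show n + i ≤ n + k by omega) (show n + j ≤ n + k by omega) h1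
    omega

/-- The split `ω ↦ (prefix, twisted suffix)` is injective on `(n+k)`-step honeycomb walks.
[cite: MadrasSlade1993, §1.2, eq. (1.2.3)] -/
theorem prefix_suffix_injOn (n k : ℕ) :
    Set.InjOn (fun ω : ℕ → Site 2 =>
      ((fun i => ω (min i n)), (fun i => twistAt (ω n) (ω (n + min i k) - ω n)))) ↑(saws (n + k)) := by
  intro ω hω ω' hω' h
  rw [Finset.mem_coe] at hω hω'
  simp only [Prod.mk.injEq] at h
  obtain ⟨hp, hs⟩ := h
  obtain ⟨-, hend, -, -⟩ := mem_saws_iff.1 hω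
  obtain ⟨-, hend', -, -⟩ := mem_saws_iff.1 hω'
  have hA : ∀ i ≤ n, ω i = ω' i := fun i hi => by
    have := congrFun hp i
    simp only [min_eq_left hi] at this
    exact this
  have hn : ω n = ω' n := hA n le_rfl
  have hB : ∀ j ≤ k, ω (n + j) = ω' (n + j) := fun j hj => by
    have := congrFun hs j
    simp only [min_eq_left hj, hn] at this
    have h1 := twistAt_injective (ω' n) this
    rwa [sub_left_inj] at h1
  funext i
  rcases le_or_gt i n with hi | hi
  · exact hA i hi
  · rcases le_or_gt i (n + k) with hik | hik
    · have := hB (i - n) (by omega)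
      rwa [show n + (i - n) = i by omega] at this
    · rw [hend i hik.le, hend' i hik.le]
      exact hB k le_rfl

/-- **`h_{n+k}(ℍ) ≤ h_n(ℍ) · c_k(ℍ)`**: a half-space walk splits into its first `n` steps (a half-space walk) and
its last `k` steps (any walk), injectively. [cite: MadrasSlade1993, §1.2, eq. (1.2.3) and Definition 3.1.2] -/
theorem halfSpaceCount_add_le (n k : ℕ) : halfSpaceCount (n + k) ≤ halfSpaceCount n * hexSawCount k := by
  classical
  rw [halfSpaceCount, halfSpaceCount, ← card_saws k, ← Finset.card_product]
  refine Finset.card_le_card_of_injOn (fun ω : ℕ → Site 2 =>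
      ((fun i => ω (min i n)), (fun i => twistAt (ω n) (ω (n + min i k) - ω n)))) ?_ ?_
  · intro ω hω
    rw [Finset.mem_coe] at hω
    rw [Finset.mem_coe, Finset.mem_product]
    exact ⟨prefix_mem_halfSpaceWalks hω, suffix_mem (mem_halfSpaceWalks.1 hω).1⟩
  · intro ω hω ω' hω' h
    exact prefix_suffix_injOn n k (mem_halfSpaceWalks.1 hω).1 (mem_halfSpaceWalks.1 hω').1 h

/-- `c_{n+k}(ℍ) ≤ c_n(ℍ) · c_k(ℍ)` in the function model (the tree's `hexSawCount_add_le`, re-derived by the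
twisted split). [cite: MadrasSlade1993, §1.2, eq. (1.2.3)] -/
theorem card_saws_add_le (n k : ℕ) : #(saws (n + k)) ≤ #(saws n) * #(saws k) := by
  classical
  rw [← Finset.card_product]
  refine Finset.card_le_card_of_injOn (fun ω : ℕ → Site 2 =>
      ((fun i => ω (min i n)), (fun i => twistAt (ω n) (ω (n + min i k) - ω n)))) ?_
    (prefix_suffix_injOn n k)
  intro ω hω
  rw [Finset.mem_coe] at hω
  rw [Finset.mem_coe, Finset.mem_product]
  exact ⟨prefix_mem hω, suffix_mem hω⟩

end HexBW

end Literature.Probability.RandomPlanarGeometry.SAW
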